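import Summits.AtomisticToContinuum.Crystallization.Theses.HullMinimality
import Summits.AtomisticToContinuum.Crystallization.Theorems.PhononSlackCertificatesHullBridgeWindowsOfGluing
import Summits.AtomisticToContinuum.Crystallization.Theorems.PhononSlackCertificatesHullBridgeNonLayeredFraction
import Summits.AtomisticToContinuum.Crystallization.Theorems.PhononSlackCertificatesHullBridgeCleanCentres
import Summits.AtomisticToContinuum.Crystallization.Theorems.PhononSlackCertificatesHullBridgeBadFraction
import Summits.AtomisticToContinuum.Crystallization.Theorems.ReggeStarCoercivityDefectFreeCrystallizesLayeredGluing
import Summits.AtomisticToContinuum.Crystallization.Theorems.HullMinimalityLayeredWindowsGroundStatesAreNash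
import Summits.AtomisticToContinuum.Crystallization.Theorems.HullMinimalityLayeredWindowsLocalExcess
import Summits.AtomisticToContinuum.Crystallization.Theorems.HullMinimalityLayeredWindowsGoodRegionDense
import Summits.AtomisticToContinuum.Crystallization.Theorems.HullMinimalityLayeredWindowsPatternCovering
import Summits.AtomisticToContinuum.Crystallization.Theorems.HullMinimalityLayeredWindowsCoverCount

/-!
# `NashHullBridge` (item stmt-AtomisticToContinuum-16828) and the localised clean-centre bridge to `LayeredWindows`
# (crux `HullMinimality.LayeredWindows`, stmt-AtomisticToContinuum-11778, line `registered`: its sorry-free glue)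

The tree's `HullBridge` (item 15147) is `CoerciveTwoShellGap → NearFieldConvexity →` layered windows, by the GLOBAL
clean-centre argument (`HullBridgeExact.stub_cleanCentres`) and the gluing lemma `PrestressSplitKorn.stub_layeredGluing`.
Here the clean-centre argument is LOCALISED to one all-good ball, which weakens both antecedents:
* `cleanCentres_of` — `NashNearField` (item 16827, near field on `1/3`-separated NASH configurations) + "all-two-shell-good
  balls of every radius, eventually" ⇒ for every `(η, R')`, eventually, a particle whose `R'`-ball is all-`Good` and
  all-`LayeredNear η`.  On `Ω =` the particles of the good `ρ`-ball (Nash by `stub_groundStatesAreNash`) the near field bounds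
  `c·#{non-η-layered in Ω}` by the LOCAL excess `(E(#Ω) − #Ω e*) + Cρ² ≤ θ#Ω + Cρ²` (`stub_localExcess`,
  `energy_budget_eventually`) plus the boundary layer `11664ρ²` (`card_bdry_four_le`); the `R'`-neighbourhoods of the
  non-layered sites (`≤ (6R'+1)³` sites each) cannot cover the `≥ (ρ/(4r₀))³` particles of the half ball
  (`stub_goodRegionDense`, `stub_patternCovering`, `stub_coverCount`) once `θ ~ c/(R'³r₀³)` and `ρ ≫ C R'³ r₀³/c`;
* `layeredWindows_seq_of_goodWindows`, `layeredWindows_of_goodWindows` — windows with one spacing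
  (`HullBridgeExact.stub_windowsOfGluing`) from that qualitative leaf (stub S1 of the line) and `NashNearField`;
* `goodWindows_of_badFraction` (packing), `badFraction_of_nashTwoShellGap` (item 16826 on ground states), and
  `nashHullBridge_proof : NashClassCertificates.NashHullBridge` — item 16828 BY NAME.
-/

noncomputable section

open scoped BigOperators Classical InnerProductSpace
open Filter Topology

namespace Summit.AtomisticToContinuum.Crystallization.Theorems.LayeredWindowsLocal

open Summit.AtomisticToContinuum.Crystallization.Theses
open Summit.AtomisticToContinuum.Crystallization.Theorems.PrestressSplitKorn
open Summit.AtomisticToContinuum.Crystallization.Theorems.DefectFreeCrystallizes.Negative.PredicateAPI (Good)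
open Literature.MathematicalPhysics.StatisticalMechanics Literature.Geometry.DiscreteGeometry

-- `E3 = EuclideanSpace ℝ (Fin 3)` as the (reducible) library abbreviation (no notation declared here).
open Summit.AtomisticToContinuum.Crystallization.Theorems.ChargedEnergyGapNegative (E3)

/-! ## The energy budget `E(n) ≤ n (e* + θ)` eventually -/
/-- `E(n) ≤ n·(e* + θ)` for all large `n` (`E(n)/n → e*`, `ChargedEnergyGapNegative.crysEnergyLimit`). -/
theorem energy_budget_eventually {θ : ℝ} (hθ : 0 < θ) :
    ∃ N₀ : ℕ, ∀ n : ℕ, N₀ ≤ n → groundStateEnergy lennardJones 3 n ≤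
      (n : ℝ) * ((⨅ Q : PeriodicConfiguration 3, Q.energyPerParticle lennardJones) + θ) := by
  set e : ℝ := ⨅ Q : PeriodicConfiguration 3, Q.energyPerParticle lennardJones with he
  have hlim := ChargedEnergyGapNegative.crysEnergyLimit
  have hev : ∀ᶠ n : ℕ in atTop, groundStateEnergy lennardJones 3 n / n < e + θ :=
    hlim (Iio_mem_nhds (by linarith))
  obtain ⟨N₀, hN₀⟩ := eventually_atTop.1 (hev.and (eventually_ge_atTop 1))
  refine ⟨N₀, fun n hn => ?_⟩
  obtain ⟨h1, h2⟩ := hN₀ n hn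
  have hnpos : (0 : ℝ) < n := by exact_mod_cast h2
  rw [div_lt_iff₀ hnpos] at h1
  linarith

/-! ## Counting in a `1/3`-separated configuration -/
section Counting

variable {N : ℕ}

/-- The boundary layer of depth `4` of the ball `Ω = {i : dist (x i) c ≤ ρ}` (sites of `Ω` within `4` of a site outside
`Ω`) holds at most `11664 ρ²` sites of a `1/3`-separated configuration (`card_shell_le`, four unit shells). -/
theorem card_bdry_four_le {x : Fin N → E3} (hsep : ∀ i j : Fin N, i ≠ j → (1 / 3 : ℝ) ≤ dist (x i) (x j))
    (c : E3) {ρ : ℝ} (hρ : 1 ≤ ρ) :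
    (((Finset.univ.filter fun i : Fin N => dist (x i) c ≤ ρ).filter fun i =>
        ∃ j : Fin N, j ∉ (Finset.univ.filter fun i : Fin N => dist (x i) c ≤ ρ) ∧ dist (x j) (x i) ≤ 4).card : ℝ)
      ≤ 11664 * ρ ^ 2 := by
  classical
  set Ω := Finset.univ.filter fun i : Fin N => dist (x i) c ≤ ρ with hΩ
  set shell : ℕ → Finset (Fin N) := fun k =>
    Finset.univ.filter fun i : Fin N => ρ - k - 1 < dist (x i) c ∧ dist (x i) c ≤ ρ - k with hshell
  have hsub : (Ω.filter fun i => ∃ j : Fin N, j ∉ Ω ∧ dist (x j) (x i) ≤ 4) ⊆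
      (Finset.range 4).biUnion shell := by
    intro i hi
    rw [Finset.mem_filter] at hi
    obtain ⟨hiΩ, j, hjΩ, hji⟩ := hi
    have hic : dist (x i) c ≤ ρ := (Finset.mem_filter.1 hiΩ).2
    have hjc : ρ < dist (x j) c := by
      by_contra h
      exact hjΩ (Finset.mem_filter.2 ⟨Finset.mem_univ _, not_lt.1 h⟩)
    have hlow : ρ - 4 < dist (x i) c := by
      have := dist_triangle (x j) (x i) c
      linarith
    set t : ℝ := ρ - dist (x i) c with ht
    have ht0 : 0 ≤ t := by linarith
    have ht4 : t < 4 := by linarith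
    set k : ℕ := ⌊t⌋₊ with hk
    have hk4 : k < 4 := by
      rw [hk, Nat.floor_lt ht0]
      exact_mod_cast ht4
    refine Finset.mem_biUnion.2 ⟨k, Finset.mem_range.2 hk4, ?_⟩
    rw [hshell, Finset.mem_filter]
    refine ⟨Finset.mem_univ _, ?_, ?_⟩
    · have := Nat.lt_floor_add_one t
      rw [← hk] at this
      linarith
    · have := Nat.floor_le ht0
      rw [← hk] at this
      linarith
  have hshell_le : ∀ k : ℕ, ((shell k).card : ℝ) ≤ 108 * (1 / 3 : ℝ)⁻¹ ^ 3 * ρ ^ 2 := fun k =>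
    card_shell_le (by norm_num) (by norm_num) x hsep c hρ k
  calc (((Ω.filter fun i => ∃ j : Fin N, j ∉ Ω ∧ dist (x j) (x i) ≤ 4)).card : ℝ)
      ≤ (((Finset.range 4).biUnion shell).card : ℝ) := by exact_mod_cast Finset.card_le_card hsub
    _ ≤ ∑ k ∈ Finset.range 4, ((shell k).card : ℝ) := by exact_mod_cast Finset.card_biUnion_le
    _ ≤ ∑ _k ∈ Finset.range 4, 108 * (1 / 3 : ℝ)⁻¹ ^ 3 * ρ ^ 2 := Finset.sum_le_sum fun k _ => hshell_le k
    _ = 11664 * ρ ^ 2 := by rw [Finset.sum_const, Finset.card_range]; norm_num; ring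

/-- The ball `{i : dist (x i) (x i₀) ≤ ρ}` of a `1/3`-separated configuration holds at most `(6ρ + 1)³` sites. -/
theorem card_ball_le {x : Fin N → E3} (hsep : ∀ i j : Fin N, i ≠ j → (1 / 3 : ℝ) ≤ dist (x i) (x j))
    (i₀ : Fin N) {ρ : ℝ} (hρ : 0 ≤ ρ) :
    ((Finset.univ.filter fun i : Fin N => dist (x i) (x i₀) ≤ ρ).card : ℝ) ≤ (6 * ρ + 1) ^ 3 := by
  have h := squeeze_card_filter_dist_le (by norm_num : (0 : ℝ) < 1 / 3) hρ hsep i₀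
  have heq : (Finset.univ.filter fun i : Fin N => dist (x i) (x i₀) ≤ ρ) =
      Finset.univ.filter fun i : Fin N => dist (x i₀) (x i) ≤ ρ := by
    ext i; simp [dist_comm]
  rw [heq]
  calc ((Finset.univ.filter fun i : Fin N => dist (x i₀) (x i) ≤ ρ).card : ℝ) ≤ (2 * ρ / (1 / 3) + 1) ^ 3 := h
    _ = (6 * ρ + 1) ^ 3 := by ring

end Counting

/-! ## The localised clean-centre argument -/
set_option maxHeartbeats 400000 in
/-- **Clean centres, localised** (the localisation of `HullBridgeExact.stub_cleanCentres` to ONE all-good ball). Along a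
Lennard-Jones ground-state sequence with all-two-shell-good balls of every radius eventually (`hgood`), the Nash-class near
field `NashNearField` (item 16827) gives, for every `(η, R')`, eventually in `N`, a particle whose `R'`-ball is all-good and
all-`η`-layered-near: on `Ω =` the particles of the all-good `ρ`-ball, `c·#{non-η-layered in Ω} ≤` local excess
(`stub_localExcess` + `E(n)/n → e*`) `+` boundary layer `O(ρ²)`, while the half ball holds `≥ (ρ/(4r₀))³` particles
(`stub_goodRegionDense`, `stub_patternCovering`, `stub_coverCount`); pigeonhole. -/
theorem cleanCentres_of (hNF : Summit.AtomisticToContinuum.Crystallization.Theses.NashClassCertificates.NashNearField)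
    (x : (N : ℕ) → (Fin N → E3)) (hx : ∀ N, IsGroundState lennardJones (x N))
    (hgood : ∀ ρ : ℝ, ∀ᶠ N : ℕ in atTop, ∃ i : Fin N, ∀ j : Fin N,
      dist (x N j) (x N i) ≤ ρ → IsTwoShellGood (1 / 20) (47 / 50) 1 (x N) j) :
    ∀ η : ℝ, 0 < η → ∀ R' : ℝ, ∀ᶠ N : ℕ in atTop, ∃ i : Fin N, ∀ j : Fin N,
      dist (x N j) (x N i) ≤ R' → Good (x N) j ∧ LayeredNear η (x N) j := by
  intro η hη R'
  classical
  set R₀ : ℝ := max R' 0 with hR₀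
  have hR₀0 : 0 ≤ R₀ := le_max_right _ _
  have hR'R₀ : R' ≤ R₀ := le_max_left _ _
  obtain ⟨c, hc, Cnf, hNF⟩ := hNF η hη
  obtain ⟨C₄, hC₄⟩ := stub_localExcess
  obtain ⟨r₀, hr₀1, hdense⟩ := stub_goodRegionDense (2 / 11) (by norm_num) stub_patternCovering
  have hr₀ : 0 < r₀ := by linarith
  obtain ⟨K₁, hK₁def⟩ : ∃ K₁ : ℝ, K₁ = (6 * R₀ + 1) ^ 3 / c := ⟨_, rfl⟩
  have hK₁ : 0 < K₁ := by rw [hK₁def]; positivity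
  obtain ⟨C₅, hC₅def⟩ : ∃ C₅ : ℝ, C₅ = max C₄ 0 + max Cnf 0 * 11664 := ⟨_, rfl⟩
  have hC₅ : 0 ≤ C₅ := by rw [hC₅def]; positivity
  obtain ⟨θ, hθ0, hθK⟩ : ∃ θ : ℝ, 0 < θ ∧ K₁ * θ * 343 ≤ 1 / (128 * r₀ ^ 3) := by
    refine ⟨1 / (43904 * r₀ ^ 3 * K₁ + 1), by positivity, ?_⟩
    rw [le_div_iff₀ (by positivity)]
    have h1 : 1 / (43904 * r₀ ^ 3 * K₁ + 1) * (43904 * r₀ ^ 3 * K₁ + 1) = 1 := by field_simp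
    have h2 : K₁ * (1 / (43904 * r₀ ^ 3 * K₁ + 1)) * 343 * (128 * r₀ ^ 3) =
        1 / (43904 * r₀ ^ 3 * K₁ + 1) * (43904 * r₀ ^ 3 * K₁ + 1) - 1 / (43904 * r₀ ^ 3 * K₁ + 1) := by ring
    have h3 : 0 < 1 / (43904 * r₀ ^ 3 * K₁ + 1) := by positivity
    rw [h2]
    linarith
  obtain ⟨N₀, hN₀⟩ := energy_budget_eventually hθ0
  obtain ⟨ρ, hρ1, hρ2, hρ3⟩ : ∃ ρ : ℝ, 4 * r₀ * ((N₀ : ℝ) + 1) ≤ ρ ∧ 2 * R₀ + 1 ≤ ρ ∧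
      128 * r₀ ^ 3 * K₁ * C₅ + 1 ≤ ρ :=
    ⟨max (max (4 * r₀ * ((N₀ : ℝ) + 1)) (2 * R₀ + 1)) (128 * r₀ ^ 3 * K₁ * C₅ + 1),
      (le_max_left _ _).trans (le_max_left _ _), (le_max_right _ _).trans (le_max_left _ _), le_max_right _ _⟩
  have hN₀nn : (0 : ℝ) ≤ N₀ := Nat.cast_nonneg _
  have hρ4r₀ : 4 * r₀ ≤ ρ := by nlinarith
  have hρone : 1 ≤ ρ := by linarith
  have hρpos : 0 < ρ := by linarith
  filter_upwards [hgood ρ] with N hN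
  obtain ⟨i₀, hi₀⟩ := hN
  have hinj : Function.Injective (x N) := (hx N).1
  have hsep : ∀ i j : Fin N, i ≠ j → (1 / 3 : ℝ) ≤ dist (x N i) (x N j) := fun i j hij =>
    ZeroDefectDensity.third_le_dist_of_isGroundState (hx N) hij
  have hnash := stub_groundStatesAreNash N (x N) (hx N)
  have hloc := hC₄ N (x N) (hx N) (x N i₀) ρ hρone
  set Ω := Finset.univ.filter fun i : Fin N => dist (x N i) (x N i₀) ≤ ρ with hΩ
  have hΩgood : ∀ i ∈ Ω, IsTwoShellGood (1 / 20) (47 / 50) 1 (x N) i := fun i hi =>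
    hi₀ i (Finset.mem_filter.1 hi).2
  have hnf0 := hNF N (x N) hsep hnash Ω hΩgood
  rw [HullBridgeExact.nl_card_inline_eq η (x N) Ω, HullBridgeExact.nl_card_bdry_eq (x N) Ω 4] at hnf0
  set e : ℝ := ⨅ Q : PeriodicConfiguration 3, Q.energyPerParticle lennardJones with he
  have hsum : ∑ i ∈ Ω, ((1 / 2 : ℝ) * (∑ j ∈ Finset.univ.erase i, lennardJones (dist (x N i) (x N j))) - e) =
      (∑ i ∈ Ω, (1 / 2 : ℝ) * siteEnergy lennardJones (x N) i) - (Ω.card : ℝ) * e := by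
    rw [Finset.sum_sub_distrib, Finset.sum_const, nsmul_eq_mul]
    rfl
  rw [hsum] at hnf0
  set D := Ω.filter fun i => ¬ LayeredNear η (x N) i with hD
  set Bd := Ω.filter fun i => ∃ j : Fin N, j ∉ Ω ∧ dist (x N j) (x N i) ≤ 4 with hBd
  have hbd : (Bd.card : ℝ) ≤ 11664 * ρ ^ 2 := card_bdry_four_le hsep (x N i₀) hρone
  have hnle : (Ω.card : ℝ) ≤ (6 * ρ + 1) ^ 3 := card_ball_le hsep i₀ hρpos.le
  set T := Finset.univ.filter fun i : Fin N => dist (x N i) (x N i₀) ≤ ρ / 2 with hT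
  have hTΩ : T ⊆ Ω := by
    intro i hi
    rw [hT, Finset.mem_filter] at hi
    exact Finset.mem_filter.2 ⟨Finset.mem_univ _, by linarith [hi.2]⟩
  have hTcard : (ρ / (4 * r₀)) ^ 3 ≤ (T.card : ℝ) := by
    have hR : 0 ≤ ρ / 2 - r₀ := by linarith
    have hcov : ∀ y : E3, dist y (x N i₀) ≤ ρ / 2 - r₀ →
        ∃ q ∈ Finset.univ.image (x N), dist q y < r₀ := by
      intro y hy
      obtain ⟨j, hj⟩ := hdense N (x N) i₀ ρ hi₀ y (by linarith)
      exact ⟨x N j, Finset.mem_image_of_mem _ (Finset.mem_univ j), hj⟩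
    have hcnt := stub_coverCount r₀ (ρ / 2 - r₀) hr₀ hR (x N i₀) (Finset.univ.image (x N)) hcov
    have himg : ((Finset.univ.image (x N)).filter fun q => dist q (x N i₀) ≤ ρ / 2 - r₀ + r₀) =
        T.image (x N) := by
      rw [hT, Finset.filter_image]
      congr 1
      ext i
      simp
    rw [himg, Finset.card_image_of_injective _ hinj] at hcnt
    have hle : ρ / (4 * r₀) ≤ (ρ / 2 - r₀) / r₀ := by
      rw [div_le_div_iff₀ (by positivity) hr₀]
      nlinarith [mul_le_mul_of_nonneg_right hρ4r₀ hr₀.le]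
    calc (ρ / (4 * r₀)) ^ 3 ≤ ((ρ / 2 - r₀) / r₀) ^ 3 := pow_le_pow_left₀ (by positivity) hle 3
      _ ≤ (T.card : ℝ) := hcnt
  have hnN₀ : N₀ ≤ Ω.card := by
    have hb : (1 : ℝ) ≤ ρ / (4 * r₀) := by
      rw [le_div_iff₀ (by positivity)]; linarith
    have h0 : (N₀ : ℝ) + 1 ≤ ρ / (4 * r₀) := by
      rw [le_div_iff₀ (by positivity)]; linarith
    have h1 : ρ / (4 * r₀) ≤ (ρ / (4 * r₀)) ^ 3 := by
      calc ρ / (4 * r₀) = (ρ / (4 * r₀)) ^ 1 := (pow_one _).symm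
        _ ≤ (ρ / (4 * r₀)) ^ 3 := pow_le_pow_right₀ hb (by norm_num)
    have h2 : (T.card : ℝ) ≤ (Ω.card : ℝ) := by exact_mod_cast Finset.card_le_card hTΩ
    have h3 : (N₀ : ℝ) ≤ (Ω.card : ℝ) := by linarith
    exact_mod_cast h3
  have hEn : groundStateEnergy lennardJones 3 Ω.card ≤ (Ω.card : ℝ) * e + (Ω.card : ℝ) * θ := by
    have := hN₀ Ω.card hnN₀
    rw [mul_add] at this
    exact this
  have hDle : c * (D.card : ℝ) ≤ θ * (6 * ρ + 1) ^ 3 + C₅ * ρ ^ 2 := by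
    have h1 : c * (D.card : ℝ) ≤ (Ω.card : ℝ) * θ + C₄ * ρ ^ 2 + Cnf * (Bd.card : ℝ) := by
      linarith [hnf0, hloc, hEn]
    have h2 : Cnf * (Bd.card : ℝ) ≤ max Cnf 0 * (11664 * ρ ^ 2) :=
      calc Cnf * (Bd.card : ℝ) ≤ max Cnf 0 * (Bd.card : ℝ) :=
            mul_le_mul_of_nonneg_right (le_max_left _ _) (Nat.cast_nonneg _)
        _ ≤ max Cnf 0 * (11664 * ρ ^ 2) := mul_le_mul_of_nonneg_left hbd (le_max_right _ _)
    have h3 : C₄ * ρ ^ 2 ≤ max C₄ 0 * ρ ^ 2 := mul_le_mul_of_nonneg_right (le_max_left _ _) (by positivity)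
    have h4 : (Ω.card : ℝ) * θ ≤ θ * (6 * ρ + 1) ^ 3 := by
      rw [mul_comm]
      exact mul_le_mul_of_nonneg_left hnle hθ0.le
    have h5 : C₅ * ρ ^ 2 = max C₄ 0 * ρ ^ 2 + max Cnf 0 * (11664 * ρ ^ 2) := by rw [hC₅def]; ring
    rw [h5]
    linarith [h1, h2, h3, h4]
  set Sp := Finset.univ.filter fun i : Fin N => ∃ k ∈ D, dist (x N k) (x N i) ≤ R₀ with hSp
  have hSple : (Sp.card : ℝ) ≤ (6 * R₀ + 1) ^ 3 * (D.card : ℝ) := by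
    have := squeeze_card_filter_exists_near_le (by norm_num : (0 : ℝ) < 1 / 3) hR₀0 hsep D
    calc (Sp.card : ℝ) ≤ (2 * R₀ / (1 / 3) + 1) ^ 3 * (D.card : ℝ) := this
      _ = (6 * R₀ + 1) ^ 3 * (D.card : ℝ) := by ring
  have hSplt : (Sp.card : ℝ) < (T.card : ℝ) := by
    have h1 : (Sp.card : ℝ) ≤ K₁ * (θ * (6 * ρ + 1) ^ 3 + C₅ * ρ ^ 2) :=
      calc (Sp.card : ℝ) ≤ (6 * R₀ + 1) ^ 3 * (D.card : ℝ) := hSple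
        _ = K₁ * (c * (D.card : ℝ)) := by rw [hK₁def]; field_simp
        _ ≤ K₁ * (θ * (6 * ρ + 1) ^ 3 + C₅ * ρ ^ 2) := mul_le_mul_of_nonneg_left hDle hK₁.le
    have h67 : (6 * ρ + 1) ^ 3 ≤ 343 * ρ ^ 3 := by
      have h7 : (6 * ρ + 1) ^ 3 ≤ (7 * ρ) ^ 3 := pow_le_pow_left₀ (by positivity) (by linarith) 3
      have h8 : (7 * ρ) ^ 3 = 343 * ρ ^ 3 := by ring
      linarith
    have h2 : K₁ * (θ * (6 * ρ + 1) ^ 3) ≤ ρ ^ 3 / (128 * r₀ ^ 3) :=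
      calc K₁ * (θ * (6 * ρ + 1) ^ 3) ≤ K₁ * (θ * (343 * ρ ^ 3)) :=
            mul_le_mul_of_nonneg_left (mul_le_mul_of_nonneg_left h67 hθ0.le) hK₁.le
        _ = (K₁ * θ * 343) * ρ ^ 3 := by ring
        _ ≤ (1 / (128 * r₀ ^ 3)) * ρ ^ 3 := mul_le_mul_of_nonneg_right hθK (by positivity)
        _ = ρ ^ 3 / (128 * r₀ ^ 3) := by ring
    have h3 : K₁ * (C₅ * ρ ^ 2) < ρ ^ 3 / (128 * r₀ ^ 3) := by
      rw [lt_div_iff₀ (by positivity)]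
      have hA : 128 * r₀ ^ 3 * K₁ * C₅ ≤ ρ - 1 := by linarith
      have hB := mul_le_mul_of_nonneg_right hA (sq_nonneg ρ)
      calc K₁ * (C₅ * ρ ^ 2) * (128 * r₀ ^ 3) = 128 * r₀ ^ 3 * K₁ * C₅ * ρ ^ 2 := by ring
        _ ≤ (ρ - 1) * ρ ^ 2 := hB
        _ < ρ ^ 3 := by nlinarith [sq_nonneg ρ, hρpos]
    have h4 : ρ ^ 3 / (128 * r₀ ^ 3) + ρ ^ 3 / (128 * r₀ ^ 3) = (ρ / (4 * r₀)) ^ 3 := by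
      field_simp
      ring
    calc (Sp.card : ℝ) ≤ K₁ * (θ * (6 * ρ + 1) ^ 3 + C₅ * ρ ^ 2) := h1
      _ = K₁ * (θ * (6 * ρ + 1) ^ 3) + K₁ * (C₅ * ρ ^ 2) := by ring
      _ < ρ ^ 3 / (128 * r₀ ^ 3) + ρ ^ 3 / (128 * r₀ ^ 3) := by linarith
      _ = (ρ / (4 * r₀)) ^ 3 := h4
      _ ≤ (T.card : ℝ) := hTcard
  obtain ⟨i₁, hi₁T, hi₁Sp⟩ : ∃ i₁ ∈ T, i₁ ∉ Sp := by
    by_contra h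
    push Not at h
    have hle : T.card ≤ Sp.card := Finset.card_le_card h
    have : (T.card : ℝ) ≤ (Sp.card : ℝ) := by exact_mod_cast hle
    linarith
  refine ⟨i₁, fun j hj => ?_⟩
  have hi₁c : dist (x N i₁) (x N i₀) ≤ ρ / 2 := (Finset.mem_filter.1 hi₁T).2
  have hjR₀ : dist (x N j) (x N i₁) ≤ R₀ := hj.trans hR'R₀
  have hjΩ : j ∈ Ω := by
    refine Finset.mem_filter.2 ⟨Finset.mem_univ _, ?_⟩
    have := dist_triangle (x N j) (x N i₁) (x N i₀)
    linarith
  have hjgood : IsTwoShellGood (1 / 20) (47 / 50) 1 (x N) j := hΩgood j hjΩ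
  refine ⟨HullBridgeExact.cc_good_of_isTwoShellGood hinj hjgood, ?_⟩
  by_contra hnl
  have hjD : j ∈ D := Finset.mem_filter.2 ⟨hjΩ, hnl⟩
  exact hi₁Sp (Finset.mem_filter.2 ⟨Finset.mem_univ _, j, hjD, hjR₀⟩)

/-! ## Layered windows from good windows; good windows from an `o(N)` bad fraction -/
/-- **The localised bridge**: along a Lennard-Jones ground-state sequence, all-two-shell-good balls of every radius,
eventually, plus `NashNearField` give layered windows at every scale with ONE in-layer spacing `a ∈ [47/50, 1]` (the
conclusion of `HullMinimality.LayeredWindows` for the sequence): clean centres (`cleanCentres_of`) fed into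
`HullBridgeExact.stub_windowsOfGluing` with the gluing lemma `PrestressSplitKorn.stub_layeredGluing`. -/
theorem layeredWindows_seq_of_goodWindows
    (hNF : Summit.AtomisticToContinuum.Crystallization.Theses.NashClassCertificates.NashNearField)
    (x : (N : ℕ) → (Fin N → E3)) (hx : ∀ N, IsGroundState lennardJones (x N))
    (hgood : ∀ ρ : ℝ, ∀ᶠ N : ℕ in atTop, ∃ i : Fin N, ∀ j : Fin N,
      dist (x N j) (x N i) ≤ ρ → IsTwoShellGood (1 / 20) (47 / 50) 1 (x N) j) :
    ∃ a : ℝ, 47 / 50 ≤ a ∧ a ≤ 1 ∧ ∀ R ε : ℝ, 0 < ε → ∃ᶠ N in Filter.atTop,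
      ∃ (A : E3 →ₗᵢ[ℝ] E3) (t : E3) (s : ℤ → ℤ) (z : ℤ → ℝ), IsHaggSeq s ∧
        (∀ m : ℤ, 39 / 50 * a ≤ z (m + 1) - z m ∧ z (m + 1) - z m ≤ 17 / 20 * a) ∧
        let S : Set E3 := {p | ∃ m i j : ℤ, p = A (((i : ℝ) • triangularVec₁ a) +
          ((j : ℝ) • triangularVec₂ a) + ((haggLabel s m : ℝ) • barlowOffset a) + (z m • layerNormal 1))}
        (∀ p ∈ S, ‖p‖ ≤ R → ∃ i : Fin N, dist (x N i + t) p ≤ ε) ∧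
          (∀ i : Fin N, ‖x N i + t‖ ≤ R → ∃ p ∈ S, dist (x N i + t) p ≤ ε) :=
  HullBridgeExact.stub_windowsOfGluing stub_layeredGluing x hx (cleanCentres_of hNF x hx hgood)

/-- **`LayeredWindows` (stmt-11778) from the qualitative positional leaf and the Nash near field**: if along EVERY
ground-state sequence all-two-shell-good balls of every radius exist eventually (stub S1 `stub_twoShellGoodWindows` of the
line), then `NashNearField → HullMinimality.LayeredWindows`. -/
theorem layeredWindows_of_goodWindows
    (hgood : ∀ x : (N : ℕ) → (Fin N → E3), (∀ N, IsGroundState lennardJones (x N)) → ∀ ρ : ℝ,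
      ∀ᶠ N : ℕ in atTop, ∃ i : Fin N, ∀ j : Fin N,
        dist (x N j) (x N i) ≤ ρ → IsTwoShellGood (1 / 20) (47 / 50) 1 (x N) j)
    (hNF : Summit.AtomisticToContinuum.Crystallization.Theses.NashClassCertificates.NashNearField) :
    Summit.AtomisticToContinuum.Crystallization.Theses.HullMinimality.LayeredWindows :=
  fun x hx => layeredWindows_seq_of_goodWindows hNF x hx (hgood x hx)

/-- **Good windows from an `o(N)` bad fraction** (packing): if the fraction of non-two-shell-good sites of `x N`
tends to `0`, then for every radius `ρ`, for all large `N`, some particle has every particle within `ρ` of it two-shell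
good (`hb_exists_far_from` with the `1/3`-separation of ground states). -/
theorem goodWindows_of_badFraction (x : (N : ℕ) → (Fin N → E3)) (hx : ∀ N, IsGroundState lennardJones (x N))
    (hbad : Tendsto (fun N : ℕ =>
      (Nat.card {i : Fin N // ¬ IsTwoShellGood (1 / 20) (47 / 50) 1 (x N) i} : ℝ) / N) atTop (𝓝 0))
    (ρ : ℝ) :
    ∀ᶠ N : ℕ in atTop, ∃ i : Fin N, ∀ j : Fin N,
      dist (x N j) (x N i) ≤ ρ → IsTwoShellGood (1 / 20) (47 / 50) 1 (x N) j := by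
  classical
  set M : ℝ := (2 * max ρ 0 / (1 / 3) + 1) ^ 3 with hM
  have hM0 : 0 < M := by positivity
  have ht : Tendsto (fun N : ℕ => M * ((Nat.card {i : Fin N // ¬ IsTwoShellGood (1 / 20) (47 / 50) 1 (x N) i} : ℝ) / N))
      atTop (𝓝 0) := by simpa using hbad.const_mul M
  filter_upwards [ht.eventually_lt_const zero_lt_one, eventually_gt_atTop 0] with N hN1 hN0
  have hNpos : (0 : ℝ) < N := by exact_mod_cast hN0
  set D := Finset.univ.filter fun i : Fin N => ¬ IsTwoShellGood (1 / 20) (47 / 50) 1 (x N) i with hD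
  have hDcard : (Nat.card {i : Fin N // ¬ IsTwoShellGood (1 / 20) (47 / 50) 1 (x N) i} : ℝ) = D.card := by
    rw [Nat.card_eq_fintype_card, Fintype.card_subtype]
  rw [hDcard, ← mul_div_assoc, div_lt_iff₀ hNpos, one_mul] at hN1
  have hsep : ∀ i j : Fin N, i ≠ j → (1 / 3 : ℝ) ≤ dist (x N i) (x N j) := fun i j hij =>
    ZeroDefectDensity.third_le_dist_of_isGroundState (hx N) hij
  obtain ⟨i, hi⟩ := hb_exists_far_from (x N) (by norm_num : (0 : ℝ) < 1 / 3) (le_max_right ρ 0) hsep D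
    (by rw [mul_comm]; exact hN1)
  refine ⟨i, fun j hj => ?_⟩
  by_contra hbadj
  exact hi j (hj.trans (le_max_left _ _)) (Finset.mem_filter.2 ⟨Finset.mem_univ _, hbadj⟩)

/-- **The bad fraction vanishes under `NashTwoShellGap`** (item 16826): ground states are `1/3`-separated
(`third_le_dist_of_isGroundState`) and Nash (`stub_groundStatesAreNash`), so the Nash-class gap applies to them, and the
`o(N)` energy budget `squeeze_tendsto_excess_div` makes the bad fraction vanish (as in `HullBridgeExact.stub_badFraction`). -/
theorem badFraction_of_nashTwoShellGap
    (hG : Summit.AtomisticToContinuum.Crystallization.Theses.NashClassCertificates.NashTwoShellGap)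
    (x : (N : ℕ) → (Fin N → E3)) (hx : ∀ N, IsGroundState lennardJones (x N)) :
    Tendsto (fun N : ℕ =>
      (Nat.card {i : Fin N // ¬ IsTwoShellGood (1 / 20) (47 / 50) 1 (x N) i} : ℝ) / N) atTop (𝓝 0) := by
  obtain ⟨g, hg, hgap⟩ := hG
  have hlim : Tendsto (fun N : ℕ => (interactionEnergy lennardJones (x N) -
      (N : ℝ) * (⨅ Q : PeriodicConfiguration 3, Q.energyPerParticle lennardJones)) / N / g)
      atTop (𝓝 0) := by
    simpa only [zero_div] using (squeeze_tendsto_excess_div x hx).div_const g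
  refine squeeze_zero (fun N => by positivity) (fun N => ?_) hlim
  exact HullBridgeExact.bf_div_le N hg (hgap N (x N)
    (fun i j hij => ZeroDefectDensity.third_le_dist_of_isGroundState (hx N) hij)
    (stub_groundStatesAreNash N (x N) (hx N)))

/-- **Good windows under `NashTwoShellGap`** (item 16826): `badFraction_of_nashTwoShellGap` + packing. -/
theorem goodWindows_of_nashTwoShellGap
    (hG : Summit.AtomisticToContinuum.Crystallization.Theses.NashClassCertificates.NashTwoShellGap)
    (x : (N : ℕ) → (Fin N → E3)) (hx : ∀ N, IsGroundState lennardJones (x N)) (ρ : ℝ) :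
    ∀ᶠ N : ℕ in atTop, ∃ i : Fin N, ∀ j : Fin N,
      dist (x N j) (x N i) ≤ ρ → IsTwoShellGood (1 / 20) (47 / 50) 1 (x N) j :=
  goodWindows_of_badFraction x hx (badFraction_of_nashTwoShellGap hG x hx) ρ

/-- **Item stmt-AtomisticToContinuum-16828 `NashClassCertificates.NashHullBridge` holds**:
`NashTwoShellGap → NashNearField →` every sequence of Lennard-Jones ground states has layered windows at every scale —
the Nash gap gives all-good balls (`goodWindows_of_nashTwoShellGap`), the Nash near field and the localised clean-centre
argument give the windows (`layeredWindows_seq_of_goodWindows`). -/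
theorem nashHullBridge_proof : Summit.AtomisticToContinuum.Crystallization.Theses.NashClassCertificates.NashHullBridge :=
  fun hG hNF x hx => layeredWindows_seq_of_goodWindows hNF x hx (goodWindows_of_nashTwoShellGap hG x hx)

end Summit.AtomisticToContinuum.Crystallization.Theorems.LayeredWindowsLocal

end
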